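import Summits.CriticalPhenomena.SAWScalingLimit.Theorems.SAWLoopFugacityFlowAvoidanceLimitChainBookkeeping
import Summits.CriticalPhenomena.SAWScalingLimit.Theorems.SAWLoopFugacityFlowAvoidanceLimitGreenLastExit
import Literature.Probability.LatticeModels.BoundaryHarnackContraction
import HarnessLib

/-!
# Reduction of the chain exit-kernel cross-ratio bound to the annular kernel
(line `symplectic-fermion-anchor`, crux `SAWLoopFugacityFlow.AvoidanceLimit`, stmt-CriticalPhenomena-10649;
lead c4, brick W3a toward the analytic stub `stub_annularCrossRatio`)

Chelkak–Wan 2021, proof of Lemma 3.7, first display: the kernel `Z_{Θ(r)}(u, x)` of the exit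
representation across the cross-cut at scale `r` is the nonnegative mixture
`Σ_{u'} Z_{Θ(r)}(u, u') Z_{Λ(r)}(u', x)` of the ANNULAR kernel `Z_{Λ(r)}` (last visit to the inner
region), so a cross-ratio bound for the annular kernel gives the same bound for `Z_{Θ(r)}`
(`BoundaryHarnackContraction.crossRatio_mixture`). Here this is carried out for the tree's
EDGE-killed walk along the boundary Harnack chain of
`Theorems/SAWLoopFugacityFlowAvoidanceLimitHarnackChainDefs.lean`: with `R := chainR σ a₀` (the region
the walk runs in), `S' := chainS σ' a₀ ⊆ R` (the inner chain set, `σ' + δ ≤ σ`) and the "annulus"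
`A := R ∖ S'`,

* `farEscape_of_mem_chainS_of_not_mem_chainR` — an exit `x ∈ chainS σ ∖ chainR σ` far-escapes at
  level `σ` (it is adjacent to the cluster but not in it, hence not in `Θ(σ)`);
* `not_mem_chainS_of_adj_exit` — **the geometric input**: once `σ' + 2δ < σ`, no `H`-neighbour of an
  exit of the `σ`-chain lies in `S'` (two lattice steps of margin);
* `exitKernel_eq_sum_lastExit` — hence the last-exit decomposition `greenEntry_lastExit` applies to
  EVERY term of `exitKernel H R u x = Σ_{w ∈ R, w ∼ x} G_R(u, w)`, `u ∈ S'`, and reordering the finite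
  sums exhibits `exitKernel H R u ·` on the exits as the mixture with weights `¼ G_R(u, u') ≥ 0`
  (`greenEntry_nonneg`) of the annular kernel
  `AK(u', x) = Σ_{v ∈ A, v ∼ u'} Σ_{w ∈ R, w ∼ x} G_A(v, w)`;
* `exitKernel_crossRatio_of_annular` (registered signature) — the cross-ratio bound with constant `C`
  for `AK` between `S'` and the exits implies the same bound for `exitKernel H R`.

Sources: D. Chelkak, Y. Wan, Electron. J. Probab. 26 (2021) paper 54, §3.2, proof of Lemma 3.7
[ChelkakWan2021]; G. F. Lawler, *Intersections of Random Walks* (1991) §1.5 [Lawler1991].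
No definitions.
-/

noncomputable section

open scoped BigOperators Classical
open Finset
open Literature.Probability.RandomPlanarGeometry Literature.Probability.LatticeModels

namespace Summit.CriticalPhenomena.SAWScalingLimit.Theorems.AvoidanceLimit.Anchor

variable {H : SimpleGraph (Site 2)} {Λ : Finset (Site 2)} {δ : ℝ} {p : ℂ} {R : ℝ}

/-! ## Exits of the chain far-escape -/

/-- A far-escaping vertex lies at distance `≥ σ` from `p` (the escaping walk starts at it).
[folklore] -/
theorem le_dist_of_farEscape {σ : ℝ} {x : Site 2} (hx : FarEscape H δ p R σ x) :
    σ ≤ dist (meshPoint δ x) p := by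
  obtain ⟨y, w, -, hw⟩ := hx
  exact hw x w.start_mem_support

/-- **An exit of the `σ`-chain far-escapes at level `σ`.** A vertex of `chainS σ ∖ chainR σ` is not a
cluster vertex (`farCluster ⊆ chainR`), hence is adjacent to one, hence is not in `Θ(σ)` (else it
would join the cluster, `mem_farCluster_of_adj`). [folklore] -/
theorem farEscape_of_mem_chainS_of_not_mem_chainR {σ : ℝ} {a₀ x : Site 2}
    (hx : x ∈ chainS H Λ δ p R σ a₀) (hxR : x ∉ chainR H Λ δ p R σ a₀) :
    FarEscape H δ p R σ x := by
  by_contra h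
  rw [mem_chainS_iff] at hx
  obtain ⟨hxΛ, hx | ⟨w, hw, hadj⟩⟩ := hx
  · exact hxR (farCluster_subset_chainR a₀ hx)
  · exact hxR (farCluster_subset_chainR a₀
      (mem_farCluster_of_adj hw hadj (mem_farTheta_iff.2 ⟨hxΛ, h⟩)))

/-- **Two lattice steps of margin (the geometric input).** For `H ≤ ℤ²`, `0 ≤ δ` and radii
`σ' + 2δ < σ`: no `H`-neighbour `w` of an exit `x ∈ chainS σ ∖ chainR σ` lies in the inner chain set
`chainS σ'`. Indeed `x` far-escapes at level `σ` (so `dist(δx, p) ≥ σ`) and a fortiori at level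
`σ'`; if `w ∈ Θ(σ')` then `w ∈ B(p, σ')` (`dist_lt_of_mem_farTheta_of_adj_farEscape`) and
`dist(δx, p) < σ' + δ`; otherwise `w` is an escaping exit of the `σ'`-cluster, adjacent to a cluster
vertex `w₀ ∈ B(p, σ')`, so `dist(δx, p) < σ' + 2δ` — both contradict `σ' + 2δ < σ`. [folklore] -/
theorem not_mem_chainS_of_adj_exit (hH : H ≤ zdGraph 2) (hδ : 0 ≤ δ) {σ σ' : ℝ}
    (hσ : σ' + 2 * δ < σ) {a₀ w x : Site 2} (hx : x ∈ chainS H Λ δ p R σ a₀)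
    (hxR : x ∉ chainR H Λ δ p R σ a₀) (hadj : H.Adj w x) : w ∉ chainS H Λ δ p R σ' a₀ := by
  intro hw
  have hxE : FarEscape H δ p R σ x := farEscape_of_mem_chainS_of_not_mem_chainR hx hxR
  have hxd : σ ≤ dist (meshPoint δ x) p := le_dist_of_farEscape hxE
  have hxE' : FarEscape H δ p R σ' x := hxE.mono (by linarith)
  rw [mem_chainS_iff] at hw
  obtain ⟨hwΛ, hw'⟩ := hw
  by_cases hwT : w ∈ farTheta H Λ δ p R σ'
  · have hwd : dist (meshPoint δ w) p < σ' :=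
      dist_lt_of_mem_farTheta_of_adj_farEscape hwT hadj hxE'
    have := dist_meshPoint_lt_add_of_adj hδ hwd (hH hadj)
    linarith
  · have hwE : FarEscape H δ p R σ' w := by
      by_contra h
      exact hwT (mem_farTheta_iff.2 ⟨hwΛ, h⟩)
    obtain hw' | ⟨w₀, hw₀, hadj₀⟩ := hw'
    · exact hwT (farCluster_subset_farTheta hw')
    · have hw₀d : dist (meshPoint δ w₀) p < σ' :=
        dist_lt_of_mem_farTheta_of_adj_farEscape (farCluster_subset_farTheta hw₀) hadj₀ hwE
      have hwd := dist_meshPoint_lt_add_of_adj hδ hw₀d (hH hadj₀)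
      have := dist_meshPoint_lt_add_of_adj hδ hwd (hH hadj)
      linarith

/-! ## The exit kernel as a mixture of the annular kernel -/

/-- **Last-exit form of the exit kernel.** For `H ≤ ℤ²`, finite `T' ⊆ T`, `u ∈ T'` and a target `x`
none of whose `H`-neighbours in `T` lies in `T'`:
`exitKernel H T u x = Σ_{u' ∈ T'} ¼ G_T(u, u') · Σ_{v ∈ T∖T', v ∼ u'} Σ_{w ∈ T, w ∼ x} G_{T∖T'}(v, w)`
— the last-exit decomposition `greenEntry_lastExit` of every term `G_T(u, w)` of the exit kernel,
with the finite sums reordered. [cite: Lawler1991, §1.5] -/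
theorem exitKernel_eq_sum_lastExit (hH : H ≤ zdGraph 2) {T T' : Finset (Site 2)} (hT'T : T' ⊆ T)
    {u x : Site 2} (hu : u ∈ T') (hx : ∀ w ∈ T, H.Adj w x → w ∉ T') :
    exitKernel H T u x = ∑ u' ∈ T', (4 : ℝ)⁻¹ * greenEntry H T u u' *
      ∑ v ∈ (T \ T').filter (fun v => H.Adj u' v), ∑ w ∈ T.filter (fun w => H.Adj w x),
        greenEntry H (T \ T') v w := by
  rw [exitKernel_eq]
  calc ∑ w ∈ T.filter (fun w => H.Adj w x), greenEntry H T u w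
      = ∑ w ∈ T.filter (fun w => H.Adj w x), ∑ u' ∈ T', greenEntry H T u u' *
          ((4 : ℝ)⁻¹ * ∑ v ∈ (T \ T').filter (fun v => H.Adj u' v), greenEntry H (T \ T') v w) := by
        refine Finset.sum_congr rfl fun w hw => ?_
        obtain ⟨hwT, hadj⟩ := Finset.mem_filter.1 hw
        exact greenEntry_lastExit H hH T T' hT'T u w hu hwT (hx w hwT hadj)
    _ = ∑ u' ∈ T', ∑ w ∈ T.filter (fun w => H.Adj w x), greenEntry H T u u' *
          ((4 : ℝ)⁻¹ * ∑ v ∈ (T \ T').filter (fun v => H.Adj u' v), greenEntry H (T \ T') v w) :=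
        Finset.sum_comm
    _ = ∑ u' ∈ T', (4 : ℝ)⁻¹ * greenEntry H T u u' *
          ∑ v ∈ (T \ T').filter (fun v => H.Adj u' v), ∑ w ∈ T.filter (fun w => H.Adj w x),
            greenEntry H (T \ T') v w := by
        refine Finset.sum_congr rfl fun u' _ => ?_
        rw [Finset.sum_comm (s := (T \ T').filter (fun v => H.Adj u' v)), Finset.mul_sum]
        refine Finset.sum_congr rfl fun w _ => ?_
        ring

/-! ## Registered brick W3a -/

/-- **Registered brick W3a: the chain exit-kernel cross-ratio bound from the annular kernel
cross-ratio bound.** For `H ≤ ℤ²`, a volume `Λ`, `0 ≤ δ`, radii `σ' + 2δ < σ` and an anchor `a₀`, write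
`R := chainR σ a₀`, `S' := chainS σ' a₀`, `A := R ∖ S'` and
`AK(u', x) := Σ_{v ∈ A, v ∼ u'} Σ_{w ∈ R, w ∼ x} G_A(v, w)` (the annular kernel). If
`AK(u', x) AK(v', y) ≤ C · AK(v', x) AK(u', y)` for all `u', v' ∈ S'` and all exits
`x, y ∈ chainS σ a₀ ∖ chainR σ a₀`, then
`exitKernel H R u x · exitKernel H R v y ≤ C · exitKernel H R v x · exitKernel H R u y` for all
`u, v ∈ S'` and all such exits. Proof: `exitKernel H R u x = Σ_{u' ∈ S'} ¼ G_R(u, u') AK(u', x)`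
(`exitKernel_eq_sum_lastExit`, applicable because no neighbour of an exit lies in `S'`,
`not_mem_chainS_of_adj_exit`, and `S' ⊆ R`, `chainS_subset_chainR_of_le`), the weights are `≥ 0`
(`greenEntry_nonneg`), and cross-ratio bounds survive nonnegative mixtures
(`BoundaryHarnackContraction.crossRatio_mixture`).
[cite: ChelkakWan2021, proof of Lemma 3.7, first display] -/
theorem exitKernel_crossRatio_of_annular :
    ∀ (H : SimpleGraph (Site 2)), H ≤ zdGraph 2 → ∀ (Λ : Finset (Site 2)) (δ : ℝ) (p : ℂ) (R σ σ' : ℝ)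
      (a₀ : Site 2) (C : ℝ), 0 ≤ δ → σ' + 2 * δ < σ →
      (∀ u' v' x y : Site 2, u' ∈ chainS H Λ δ p R σ' a₀ → v' ∈ chainS H Λ δ p R σ' a₀ →
        x ∈ chainS H Λ δ p R σ a₀ → y ∈ chainS H Λ δ p R σ a₀ →
        x ∉ chainR H Λ δ p R σ a₀ → y ∉ chainR H Λ δ p R σ a₀ →
        (∑ v ∈ (chainR H Λ δ p R σ a₀ \ chainS H Λ δ p R σ' a₀).filter (fun v => H.Adj u' v),
            ∑ w ∈ (chainR H Λ δ p R σ a₀).filter (fun w => H.Adj w x),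
              greenEntry H (chainR H Λ δ p R σ a₀ \ chainS H Λ δ p R σ' a₀) v w) *
          (∑ v ∈ (chainR H Λ δ p R σ a₀ \ chainS H Λ δ p R σ' a₀).filter (fun v => H.Adj v' v),
            ∑ w ∈ (chainR H Λ δ p R σ a₀).filter (fun w => H.Adj w y),
              greenEntry H (chainR H Λ δ p R σ a₀ \ chainS H Λ δ p R σ' a₀) v w) ≤
        C * ((∑ v ∈ (chainR H Λ δ p R σ a₀ \ chainS H Λ δ p R σ' a₀).filter (fun v => H.Adj v' v),
            ∑ w ∈ (chainR H Λ δ p R σ a₀).filter (fun w => H.Adj w x),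
              greenEntry H (chainR H Λ δ p R σ a₀ \ chainS H Λ δ p R σ' a₀) v w) *
          (∑ v ∈ (chainR H Λ δ p R σ a₀ \ chainS H Λ δ p R σ' a₀).filter (fun v => H.Adj u' v),
            ∑ w ∈ (chainR H Λ δ p R σ a₀).filter (fun w => H.Adj w y),
              greenEntry H (chainR H Λ δ p R σ a₀ \ chainS H Λ δ p R σ' a₀) v w))) →
      ∀ u v x y : Site 2, u ∈ chainS H Λ δ p R σ' a₀ → v ∈ chainS H Λ δ p R σ' a₀ →
        x ∈ chainS H Λ δ p R σ a₀ → y ∈ chainS H Λ δ p R σ a₀ →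
        x ∉ chainR H Λ δ p R σ a₀ → y ∉ chainR H Λ δ p R σ a₀ →
        exitKernel H (chainR H Λ δ p R σ a₀) u x * exitKernel H (chainR H Λ δ p R σ a₀) v y ≤
          C * (exitKernel H (chainR H Λ δ p R σ a₀) v x * exitKernel H (chainR H Λ δ p R σ a₀) u y) := by
  intro H hH Λ δ p R σ σ' a₀ C hδ hσ hAK u v x y hu hv hx hy hxR hyR
  have hS'R : chainS H Λ δ p R σ' a₀ ⊆ chainR H Λ δ p R σ a₀ :=
    chainS_subset_chainR_of_le hH hδ (by linarith) a₀
  have key := BoundaryHarnackContraction.crossRatio_mixture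
    (↑(chainS H Λ δ p R σ' a₀) : Set (Site 2)) (chainS H Λ δ p R σ' a₀)
    {z : Site 2 | z ∈ chainS H Λ δ p R σ a₀ ∧ z ∉ chainR H Λ δ p R σ a₀}
    (fun u u' => (4 : ℝ)⁻¹ * greenEntry H (chainR H Λ δ p R σ a₀) u u')
    (fun u' x => ∑ v ∈ (chainR H Λ δ p R σ a₀ \ chainS H Λ δ p R σ' a₀).filter (fun v => H.Adj u' v),
      ∑ w ∈ (chainR H Λ δ p R σ a₀).filter (fun w => H.Adj w x),
        greenEntry H (chainR H Λ δ p R σ a₀ \ chainS H Λ δ p R σ' a₀) v w)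
    (exitKernel H (chainR H Λ δ p R σ a₀)) (C := C)
    (fun u _ u' _ => mul_nonneg (by norm_num) (greenEntry_nonneg hH _ _ _))
    (fun u hu x hx => exitKernel_eq_sum_lastExit hH hS'R hu
      fun w _ hadj => not_mem_chainS_of_adj_exit hH hδ hσ hx.1 hx.2 hadj)
    (fun u' hu' v' hv' x hx y hy => hAK u' v' x y hu' hv' hx.1 hy.1 hx.2 hy.2)
  exact key u hu v hv x ⟨hx, hxR⟩ y ⟨hy, hyR⟩

end Summit.CriticalPhenomena.SAWScalingLimit.Theorems.AvoidanceLimit.Anchor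

end
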